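import Summits.ValiantsHypothesis.ValiantsHypothesis.Theorems.ValuativeGCTValuativeFlipPaddingNonMonotoneSequence
import Summits.ValiantsHypothesis.ValiantsHypothesis.Theorems.GeneratorObstructionsGenInheritanceUpper
import Summits.ValiantsHypothesis.ValiantsHypothesis.Theorems.ValuativeGCTValuativeFlipSeedTwoRow
import Literature.Computability.Complexity.OccurrenceObstructionsIPProofs
import HarnessLib

/-!
# One-step padding monotonicity FAILS for orbit-closure multiplicities, III: the crux's vocabulary
# (`paddedForm`, `rowLift`, `partitionWeightLex` on `MatIdx`)
(crux `ValuativeGCT.ValuativeFlip`, stmt-ValiantsHypothesis-12624; wall-breaker k12 gen 1, axis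
"representation-stability transfer between `m` and `m + 1`"; helper file `--supports`; parts I–II are
`…PaddingNonMonotone.lean`, `…PaddingNonMonotoneSequence.lean`)

Parts I–II refuted the every-step padding principle for binary forms (`GL₂`, letters `Fin 2`).  This part moves
the refutation into the exact objects of the crux's sub-axis S (`Cruxes/ValuativeFlip/DECOMPOSITIONS.md` S4;
the landed `eventualPaddingTransfer`, `eventualInheritance`, `orbitMultiplicity_le_rowLift_of_derivPreimage` are all
phrased with `paddedForm` / `paddedPerFormLex`, `rowLift` and `partitionWeightLex`):

* §1 TRANSPORT of `orbitMultiplicity` (general letters): it only depends on the vanishing ideal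
  (`pnm_orbitMultiplicity_eq_of_orbitVanishingIdeal_eq`, via the `GL`-equivariant `Ideal.quotientEquivAlgOfEq`);
  INHERITANCE as an equality `mult_{ext χ} ℂ[Δ_m(ι f)] = mult_χ ℂ[Δ_m(f)]` for `ι` strictly monotone onto an upper
  set of letters (`pnm_orbitMultiplicity_rename_eq`, from the tree's `map_highestWeightSpace_eq_of_apply_mk_eq` of
  `GeneratorObstructionsGenInheritanceUpper`, BLMW 2011 §5.4 / Landsberg 2017 §8.4.1); and for ANY injective
  placement `κ` of the letters (`pnm_orbitMultiplicity_rename_eq_of_injective`, one `GL`-orbit).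
* §2 `paddedForm 2 j (X_c²) = rename ![top, segEmb c] (X₀^j X₁²)` for a non-top letter `c` of `MatIdx 2`.
* §3 the verdict: `1 ≤ mult_{λ*} ℂ[Δ₃(paddedForm 2 1 (X_c²))]` for `λ = {6,3}` and
  `mult_{λ*} ℂ[Δ₄(paddedForm 2 2 (X_c²))] = 0` for `λ = {9,3}` (two-row dictionary
  `partitionWeightLex_eq_extend_pair` of `…SeedTwoRow`), hence `paddedForm_rowLift_step_monotonicity_fails`:
  ¬ ∀ n j δ g μ, `mult_{(μ♯(n+j))*} ℂ[Δ(paddedForm n j g)] ≤ mult_{(μ♯(n+j+1))*} ℂ[Δ(paddedForm n (j+1) g)]`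
  (witness `n = 2`, `j = 1`, `δ = 3`, `g = X_c²`, `μ = (3,3)`).

The padded permanent `X₀₀^{m-n} per_n` is a `paddedForm` up to the choice of block and padding letter, which is
immaterial for `orbitMultiplicity` (§1); S4 for `per_n` itself stays open (no counterexample mechanism is visible for
an irreducible inner form that is not a power — see this seat's `AXIS.md`), but it cannot follow from any principle
valid for all inner forms.

Sources: BLMW, SIAM J. Comput. 40 (2011) §5.4, §6.4 (Problem 6.10); Landsberg 2017 §8.4.1; Ikenmeyer–Panova 2017 §2;
Mulmuley–Sohoni 2001 §4–5. No new definitions.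
-/

set_option linter.dupNamespace false

namespace Summit.ValiantsHypothesis.ValiantsHypothesis.Theorems.ValuativeFlip

open scoped BigOperators Matrix
open MvPolynomial
open Literature.NumberTheory.DiophantineGeometry
open Literature.Computability.AlgebraicComplexity
open Literature.Computability.Complexity
open Literature.Barriers.ValiantsHypothesis (degIdxMap)
open Summit.ValiantsHypothesis.ValiantsHypothesis.Theorems.GenInheritance

noncomputable section

/-! ## §1 Transport of `orbitMultiplicity`: equal vanishing ideals, inheritance, placements -/

/-- **`orbitMultiplicity` only depends on the vanishing ideal** (e.g. on the `GL`-orbit): the canonical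
algebra isomorphism `ℂ[Sym^m]⧸I → ℂ[Sym^m]⧸I` of equal quotients is `GL`-equivariant and identifies the
highest-weight spaces. [folklore] -/
theorem pnm_orbitMultiplicity_eq_of_orbitVanishingIdeal_eq {τ : Type*} [Fintype τ] [LinearOrder τ] {m : ℕ}
    {f₁ f₂ : MvPolynomial τ ℂ} (hI : orbitVanishingIdeal f₁ m = orbitVanishingIdeal f₂ m) (χ : Weight τ) :
    orbitMultiplicity ℂ f₁ m χ = orbitMultiplicity ℂ f₂ m χ := by
  set Φ := Ideal.quotientEquivAlgOfEq ℂ hI with hΦdef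
  have hΦ : ∀ F, Φ (Ideal.Quotient.mk _ F) = Ideal.Quotient.mk _ F := fun F =>
    Ideal.quotientEquivAlgOfEq_mk ℂ hI F
  have hequiv : ∀ (g : GL τ ℂ) (x : OrbitCoordRing f₁ m),
      orbitCoordRep f₂ m g (Φ x) = Φ (orbitCoordRep f₁ m g x) := by
    intro g x
    obtain ⟨F, rfl⟩ := Ideal.Quotient.mk_surjective x
    rw [hΦ, orbitCoordRep_apply, orbitCoordSubst_mk, orbitCoordRep_apply, orbitCoordSubst_mk, hΦ]
  have hmap : (highestWeightSpace (orbitCoordRep f₁ m) χ).map Φ.toLinearEquiv.toLinearMap =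
      highestWeightSpace (orbitCoordRep f₂ m) χ := by
    apply le_antisymm
    · rintro _ ⟨x, hx, rfl⟩ b hb
      change orbitCoordRep f₂ m b (Φ x) = _ • Φ x
      rw [hequiv, hx b hb, map_smul]
    · intro y hy
      refine ⟨Φ.symm y, fun b hb => Φ.injective ?_, Φ.apply_symm_apply y⟩
      rw [← hequiv, AlgEquiv.apply_symm_apply, hy b hb, map_smul, AlgEquiv.apply_symm_apply]
  unfold orbitMultiplicity hwMultiplicity
  rw [← hmap]
  exact LinearEquiv.finrank_eq (Submodule.equivMapOfInjective Φ.toLinearEquiv.toLinearMap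
    Φ.toLinearEquiv.injective _)

/-- **Inheritance for `orbitMultiplicity`** (BLMW 2011 §5.4 / Landsberg 2017 §8.4.1, from the tree's
`map_highestWeightSpace_eq_of_apply_mk_eq`): for `ι : σ → τ` strictly monotone onto an upper set of letters
and a nonzero form `f` of degree `m`, the multiplicity of `χ` in `ℂ[Δ_m(f)]` equals the multiplicity of `χ`
extended by zero in `ℂ[Δ_m(ι f)]`. [folklore] -/
theorem pnm_orbitMultiplicity_rename_eq {σ τ : Type*} [Fintype σ] [LinearOrder σ] [Fintype τ] [LinearOrder τ]
    {ι : σ → τ} (hι : StrictMono ι) (hup : IsUpperSet (Set.range ι)) {m : ℕ} {f : MvPolynomial σ ℂ}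
    (hf : f.IsHomogeneous m) (hf0 : f ≠ 0) (χ : Weight σ) :
    orbitMultiplicity ℂ (rename ι f) m (Function.extend ι χ 0) = orbitMultiplicity ℂ f m χ := by
  obtain ⟨Φ, hΦ⟩ := exists_algHom_rename (k := ℂ) hι.injective hf hf0
  have hinj := injective_of_apply_mk_eq hι.injective hf hf0 Φ hΦ
  have hmap := map_highestWeightSpace_eq_of_apply_mk_eq hι hup Φ hΦ χ
  unfold orbitMultiplicity hwMultiplicity
  rw [← hmap]
  exact (LinearEquiv.finrank_eq (Submodule.equivMapOfInjective Φ.toLinearMap hinj _)).symm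

/-- **Any placement of the letters**: for an injection `κ : σ → τ` and the strictly monotone `ι` onto an
upper set, `ℂ[Δ_m(κ f)] = ℂ[Δ_m(ι f)]` (one `GL_τ`-orbit, `rename_mem_glOrbit_rename_of_injective`), so the
multiplicity of `χ` extended along `ι` in `ℂ[Δ_m(κ f)]` is the multiplicity of `χ` in `ℂ[Δ_m(f)]`. [folklore] -/
theorem pnm_orbitMultiplicity_rename_eq_of_injective {σ τ : Type*} [Fintype σ] [LinearOrder σ] [Fintype τ]
    [LinearOrder τ] {κ ι : σ → τ} (hκ : Function.Injective κ) (hι : StrictMono ι)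
    (hup : IsUpperSet (Set.range ι)) {m : ℕ} {f : MvPolynomial σ ℂ} (hf : f.IsHomogeneous m) (hf0 : f ≠ 0)
    (χ : Weight σ) :
    orbitMultiplicity ℂ (rename κ f) m (Function.extend ι χ 0) = orbitMultiplicity ℂ f m χ := by
  classical
  have horb := rename_mem_glOrbit_rename_of_injective (k := ℂ) κ ι hκ hι.injective f
  rw [← pnm_orbitMultiplicity_eq_of_orbitVanishingIdeal_eq (orbitVanishingIdeal_eq_of_mem_glOrbit horb m) _]
  exact pnm_orbitMultiplicity_rename_eq hι hup hf hf0 χ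


/-! ## §2 The padded squares `X_top^j · X_c²` are placements of the binary examples -/

/-- A non-top letter of `MatIdx 2` stays off the top after the segment embedding. [folklore] -/
theorem pnm_segEmb_ne_top {j : ℕ} {c : MatIdx 2} (hc : c ≠ topMatIdx 2) :
    segEmb (Nat.le_add_right 2 j) c ≠ topMatIdx (2 + j) := by
  intro h
  apply hc
  apply (segEmb_strictMono (Nat.le_add_right 2 j)).injective
  rw [h, segEmb_topMatIdx]

/-- The placement `0 ↦ top`, `1 ↦ segEmb c` of the two binary letters is injective. [folklore] -/
theorem pnm_placement_injective {j : ℕ} {c : MatIdx 2} (hc : c ≠ topMatIdx 2) :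
    Function.Injective (![topMatIdx (2 + j), segEmb (Nat.le_add_right 2 j) c] : Fin 2 → MatIdx (2 + j)) := by
  intro a b hab
  match a, b with
  | 0, 0 => rfl
  | 1, 1 => rfl
  | 0, 1 =>
    exact absurd ((by simpa using hab) : topMatIdx (2 + j) = segEmb (Nat.le_add_right 2 j) c)
      (pnm_segEmb_ne_top hc).symm
  | 1, 0 =>
    exact absurd ((by simpa using hab) : segEmb (Nat.le_add_right 2 j) c = topMatIdx (2 + j))
      (pnm_segEmb_ne_top hc)

/-- **`paddedForm 2 j (X_c²)` is the placement of the binary padded square `X₀^j X₁²`** (padding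
letter `↦ top`, inner letter `↦ segEmb c`). [folklore] -/
theorem pnm_paddedForm_sq_eq_rename (j : ℕ) (c : MatIdx 2) :
    paddedForm 2 j (X c ^ 2) =
      rename (![topMatIdx (2 + j), segEmb (Nat.le_add_right 2 j) c] : Fin 2 → MatIdx (2 + j))
        (X 0 ^ j * X 1 ^ 2 : MvPolynomial (Fin 2) ℂ) := by
  rw [paddedForm]
  simp only [map_mul, map_pow, rename_X, Matrix.cons_val_zero, Matrix.cons_val_one]

/-- There is a non-top letter in `MatIdx 2`. [folklore] -/
theorem pnm_exists_ne_topMatIdx_two : ∃ c : MatIdx 2, c ≠ topMatIdx 2 := by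
  refine ⟨matIdxEquiv 2 ⟨0, by norm_num⟩, fun h => ?_⟩
  have h' := congrArg (fun y => (((matIdxEquiv 2).symm y : Fin (2 * 2)) : ℕ)) h
  simp only [topMatIdx, OrderIso.symm_apply_apply] at h'
  norm_num at h'

/-! ## §3 The verdict in the crux's vocabulary -/

/-- **`(6,3)` occurs on `Δ₃(paddedForm 2 1 (X_c²))`**: for every non-top letter `c` of `MatIdx 2` and every
partition `λ` with parts `{6, 3}`, `1 ≤ mult_{λ*} ℂ[Δ₃(X_top · X_c²)]` on `MatIdx 3`
(binary `one_le_orbitMultiplicity_lin_sq_six_three` + inheritance + placement). [this crux] -/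
theorem one_le_orbitMultiplicity_paddedForm_sq_one {c : MatIdx 2} (hc : c ≠ topMatIdx 2) {D : ℕ}
    (lam : Nat.Partition D) (hlam : lam.parts = {6, 3}) :
    1 ≤ orbitMultiplicity ℂ (paddedForm 2 1 (X c ^ 2)) (2 + 1) (partitionWeightLex (2 + 1) lam) := by
  obtain ⟨ι, hι, hup, hι1, hι0⟩ := exists_topTwoEmb (2 + 1) (by norm_num)
  rw [partitionWeightLex_eq_extend_pair hι hι1 hι0 lam (show 3 ≤ 6 by norm_num) hlam,
    pnm_paddedForm_sq_eq_rename 1 c,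
    pnm_orbitMultiplicity_rename_eq_of_injective (pnm_placement_injective hc) hι hup
      (by simpa using pnm_isHomogeneous_lin_sq)
      (mul_ne_zero (pow_ne_zero _ (X_ne_zero _)) (pow_ne_zero _ (X_ne_zero _)))]
  have e : (X 0 ^ 1 * X 1 ^ 2 : MvPolynomial (Fin 2) ℂ) = X 0 * X 1 ^ 2 := by rw [pow_one]
  rw [e]
  have hw : (![-((3 : ℕ) : ℤ), -((6 : ℕ) : ℤ)] : Weight (Fin 2)) = ![-3, -6] := by norm_num
  rw [hw]
  exact one_le_orbitMultiplicity_lin_sq_six_three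

/-- **`(9,3)` does NOT occur on `Δ₄(paddedForm 2 2 (X_c²))`**: for every non-top letter `c` of `MatIdx 2`
and every partition `λ` with parts `{9, 3}`, `mult_{λ*} ℂ[Δ₄(X_top² · X_c²)] = 0` on `MatIdx 4`
(binary `orbitMultiplicity_sq_sq_nine_three_eq_zero` + inheritance + placement). [this crux] -/
theorem orbitMultiplicity_paddedForm_sq_two_eq_zero {c : MatIdx 2} (hc : c ≠ topMatIdx 2) {D : ℕ}
    (lam : Nat.Partition D) (hlam : lam.parts = {9, 3}) :
    orbitMultiplicity ℂ (paddedForm 2 2 (X c ^ 2)) (2 + 2) (partitionWeightLex (2 + 2) lam) = 0 := by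
  obtain ⟨ι, hι, hup, hι1, hι0⟩ := exists_topTwoEmb (2 + 2) (by norm_num)
  have hhom : (X 0 ^ 2 * X 1 ^ 2 : MvPolynomial (Fin 2) ℂ).IsHomogeneous (2 + 2) :=
    ((isHomogeneous_X ℂ (0 : Fin 2)).pow 2).mul ((isHomogeneous_X ℂ (1 : Fin 2)).pow 2)
  have hne : (X 0 ^ 2 * X 1 ^ 2 : MvPolynomial (Fin 2) ℂ) ≠ 0 :=
    mul_ne_zero (pow_ne_zero _ (X_ne_zero _)) (pow_ne_zero _ (X_ne_zero _))
  rw [partitionWeightLex_eq_extend_pair hι hι1 hι0 lam (show 3 ≤ 9 by norm_num) hlam,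
    pnm_paddedForm_sq_eq_rename 2 c,
    pnm_orbitMultiplicity_rename_eq_of_injective (pnm_placement_injective hc) hι hup hhom hne]
  have hw : (![-((3 : ℕ) : ℤ), -((9 : ℕ) : ℤ)] : Weight (Fin 2)) = ![-3, -9] := by norm_num
  rw [hw]
  exact orbitMultiplicity_sq_sq_nine_three_eq_zero

/-- **Every-step padding monotonicity (sub-axis S4 of this crux, general form) FAILS in the crux's own
vocabulary.**  It is NOT true that for every inner form `g` of degree `n` on `MatIdx n`, every `λ ⊢ n·δ`
with at most `n²` parts and every padding `j`, the multiplicity of `(λ♯(n+j))*` in `ℂ[Δ_{n+j}(paddedForm n j g)]`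
is at most that of `(λ♯(n+j+1))*` in `ℂ[Δ_{n+j+1}(paddedForm n (j+1) g)]`: the inner form `g = X_c²` (`c` a
non-top letter of `MatIdx 2`), `δ = 3`, `λ = (3,3)`, `j = 1` has multiplicities `≥ 1` (shape `(6,3)`) and `0`
(shape `(9,3)`).  The padded permanent `X₀₀^{m-n} per_n` is `paddedForm` up to the (immaterial) choice of block
and padding letter; S4 for `per_n` itself stays open, but cannot follow from a principle valid for all
padded forms. [this crux] -/
theorem paddedForm_rowLift_step_monotonicity_fails :
    ¬ ∀ (n j δ : ℕ) [NeZero n] [NeZero (n + j)] [NeZero (n + (j + 1))] (g : MvPolynomial (MatIdx n) ℂ)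
        (μ : Nat.Partition (n * δ)), g.IsHomogeneous n → g ≠ 0 → μ.parts.card ≤ n * n →
        orbitMultiplicity ℂ (paddedForm n j g) (n + j) (partitionWeightLex (n + j) (rowLift μ j)) ≤
          orbitMultiplicity ℂ (paddedForm n (j + 1) g) (n + (j + 1))
            (partitionWeightLex (n + (j + 1)) (rowLift μ (j + 1))) := by
  intro h
  obtain ⟨c, hc⟩ := pnm_exists_ne_topMatIdx_two
  haveI i3 : NeZero (2 + 1) := ⟨by norm_num⟩
  haveI i4 : NeZero (2 + (1 + 1)) := ⟨by norm_num⟩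
  obtain ⟨μ, hμparts⟩ : ∃ μ : Nat.Partition (2 * 3), μ.parts = {3, 3} := ⟨⟨{3, 3}, by simp, by simp⟩, rfl⟩
  obtain ⟨lam63, h63⟩ : ∃ lam : Nat.Partition ((2 + 1) * 3), lam.parts = {6, 3} :=
    ⟨⟨{6, 3}, by simp, by simp⟩, rfl⟩
  obtain ⟨lam93, h93⟩ : ∃ lam : Nat.Partition ((2 + (1 + 1)) * 3), lam.parts = {9, 3} :=
    ⟨⟨{9, 3}, by simp, by simp⟩, rfl⟩
  have hg : (X c ^ 2 : MvPolynomial (MatIdx 2) ℂ).IsHomogeneous 2 := (isHomogeneous_X ℂ c).pow 2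
  have hg0 : (X c ^ 2 : MvPolynomial (MatIdx 2) ℂ) ≠ 0 := pow_ne_zero 2 (X_ne_zero c)
  have h1 := h 2 1 3 (X c ^ 2) μ hg hg0 (by rw [hμparts]; simp)
  have h63' : lam63.parts = {3 + 1 * 3, 3} := by rw [h63]
  have h93' : lam93.parts = {3 + (1 + 1) * 3, 3} := by rw [h93]
  have e63 : partitionWeightLex (2 + 1) (rowLift μ 1) = partitionWeightLex (2 + 1) lam63 :=
    partitionWeightLex_rowLift_pair μ lam63 (le_refl 3) hμparts h63'
  have e93 : partitionWeightLex (2 + (1 + 1)) (rowLift μ (1 + 1)) = partitionWeightLex (2 + (1 + 1)) lam93 :=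
    partitionWeightLex_rowLift_pair μ lam93 (le_refl 3) hμparts h93'
  rw [e63, e93] at h1
  have hlow : 1 ≤ orbitMultiplicity ℂ (paddedForm 2 1 (X c ^ 2)) (2 + 1) (partitionWeightLex (2 + 1) lam63) :=
    one_le_orbitMultiplicity_paddedForm_sq_one hc lam63 h63
  have hzero : orbitMultiplicity ℂ (paddedForm 2 (1 + 1) (X c ^ 2)) (2 + (1 + 1))
      (partitionWeightLex (2 + (1 + 1)) lam93) = 0 :=
    orbitMultiplicity_paddedForm_sq_two_eq_zero hc lam93 h93
  have h2 := hlow.trans (h1.trans hzero.le)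
  exact absurd h2 (by norm_num)

end

end Summit.ValiantsHypothesis.ValiantsHypothesis.Theorems.ValuativeFlip
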